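import Summits.RiemannHypothesis.RiemannHypothesis.Theorems.GroundBartaEvenWinsBeyondArchDeflationSigma
import Summits.RiemannHypothesis.RiemannHypothesis.Theorems.GroundBartaEvenWinsBeyondArchDeflationWindowImageSplit
import HarnessLib

/-!
# RiemannHypothesis / GroundBarta — rung 4 (`EvenWinsBeyondArch`, stmt-RiemannHypothesis-18807 / 18085):
# the deflated Temple L-side, XV — residual norms from PANEL certificates (the assembly of the R-layer)

Helper file (`--supports stmt-RiemannHypothesis-18807`), RH-free, Mathlib + landed tree files only, no definitions,
no named facts.  Prover B, speedrun unit `sr-gb-rung-b` (gen 4).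

The sigma criterion (file XIII) asks the R-layer for `k` numbers `s_i ≥ ‖r_i‖²₂`, `r_i = F_i − Σ_l W_il v_l` the residual of
the window image of the `i`-th trial vector.  This file reduces each `s_i` to FINITELY MANY PANEL STATEMENTS about ONE explicit
real function: with `h = c/(2m)` and the panel centres `y_k = (2k+1)h`, `k < m`, covering `[0, c]`,

  `∫ ‖r_i‖² = 2 ∫_0^c R_i(y)² dy = 2 Σ_{k<m} ∫_{-h}^{h} R_i(y_k + ρ)² dρ ≤ 2 Σ_{k<m} q_k`     (`dt_residual_normSq_le_of_panels`)

where `R_i` is the REAL residual (`dt_residual_real`: the realified window image of file XIV minus `Σ_l W_il g_l`) — using the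
parity `F_i(−y) = σ F_i(y)` of the window image of a parity-`σ` profile (`dt_windowImage_reflect_parity`), the support of the
residual in `[-c, c]`, and the panel decomposition of `WeilArchDensityPanels.lean`.  Each `q_k` is then ONE Taylor-model fact
`∫_{-h}^{h} R_i(y_k + ρ)² dρ ≤ sqIntegUpperQ …` (`Literature/Analysis/ValidatedNumerics/TaylorModelL2.lean`), whose integrability
side condition is discharged here once and for all (`dt_residual_sq_intervalIntegrable`).

References: N. J. Lehmann, Numer. Math. 5 (1963) 246–272 [Lehmann1963]; F. Goerisch, H. Haunhorst, ZAMM 65 (1985) 129–135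
[GoerischHaunhorst1985] (residual norms in eigenvalue inclusions); E. Bombieri, Rend. Mat. Acc. Lincei (9) 11 (2000) Thm 2
[Bombieri2000Weil].
-/

set_option linter.dupNamespace false

noncomputable section

open MeasureTheory Set Filter
open scoped Topology BigOperators

namespace Summit.RiemannHypothesis.RiemannHypothesis.Theorems.EvenWinsBeyondArch

open Literature.NumberTheory.LFunctions

variable {c : ℝ}

/-! ## Parity of the window image -/

/-- A weighted integral of a parity-`σ` function against a weight of parity `τ` picks up the factor `σ τ`:
`∫ v(x) w(x) dx = σ τ ∫ v(x) w(x) dx` when `v(−x) = σ v(x)` and `w(−x) = τ w(x)`. -/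
theorem dt_integral_mul_parity {v : ℝ → ℂ} {w : ℝ → ℂ} {σ τ : ℂ} (hv : ∀ x, v (-x) = σ * v x)
    (hw : ∀ x, w (-x) = τ * w x) : ∫ x, v x * w x = σ * τ * ∫ x, v x * w x := by
  calc ∫ x, v x * w x = ∫ x, v (-x) * w (-x) := (integral_neg_eq_self (fun x ↦ v x * w x) volume).symm
    _ = ∫ x, σ * τ * (v x * w x) := integral_congr_ae (Eventually.of_forall fun x ↦ by
        simp only [hv, hw]; ring)
    _ = σ * τ * ∫ x, v x * w x := MeasureTheory.integral_const_mul _ _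

/-- **Parity of the window image.**  If `v(−x) = σ v(x)` for all `x`, the explicit window image satisfies
`F(−y) = σ F(y)` for all `y` (pole, prime, archimedean and killing terms separately).
[cite: Bombieri2000Weil, Thm 2 (the explicit formula's terms are reflection-covariant)] -/
theorem dt_windowImage_reflect_parity {v F : ℝ → ℂ} {σ : ℂ} (hvσ : ∀ x, v (-x) = σ * v x)
    (hF : ∀ y, F y = (Icc (-c) c).indicator (fun y ↦
        2 * (∫ x, v x * (Real.cosh (x / 2) : ℂ)) * (Real.cosh (y / 2) : ℂ) -
          2 * (∫ x, v x * (Real.sinh (x / 2) : ℂ)) * (Real.sinh (y / 2) : ℂ) +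
        (∑ n ∈ weilPrimeIndex c, (((ArithmeticFunction.vonMangoldt n : ℝ) / Real.sqrt n : ℝ) : ℂ) *
          (2 * v y - v (y - Real.log n) - v (y + Real.log n))) +
        ∫ t in Ioi 0, (weilArchDensity t : ℂ) * (2 * v y - v (y - t) - v (y + t))) y -
      (weilMarkovConstant c : ℂ) * v y) (y : ℝ) :
    F (-y) = σ * F y := by
  -- the pole coefficients: `P_c = σ P_c`, `P_s = −σ P_s`
  have hPc : ∫ x, v x * (Real.cosh (x / 2) : ℂ) = σ * ∫ x, v x * (Real.cosh (x / 2) : ℂ) := by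
    have h := dt_integral_mul_parity (τ := 1) hvσ (w := fun x ↦ (Real.cosh (x / 2) : ℂ))
      (fun x ↦ by simp only [one_mul]; rw [show -x / 2 = -(x / 2) by ring, Real.cosh_neg])
    simpa using h
  have hPs : ∫ x, v x * (Real.sinh (x / 2) : ℂ) = -σ * ∫ x, v x * (Real.sinh (x / 2) : ℂ) := by
    have h := dt_integral_mul_parity (τ := -1) hvσ (w := fun x ↦ (Real.sinh (x / 2) : ℂ))
      (fun x ↦ by rw [show -x / 2 = -(x / 2) by ring, Real.sinh_neg]; push_cast; ring)
    linear_combination h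
  -- the archimedean slice
  have harch : ∫ t in Ioi 0, (weilArchDensity t : ℂ) * (2 * v (-y) - v (-y - t) - v (-y + t)) =
      σ * ∫ t in Ioi 0, (weilArchDensity t : ℂ) * (2 * v y - v (y - t) - v (y + t)) := by
    rw [← MeasureTheory.integral_const_mul]
    refine integral_congr_ae (Eventually.of_forall fun t ↦ ?_)
    dsimp only
    rw [show -y - t = -(y + t) by ring, show -y + t = -(y - t) by ring, hvσ, hvσ, hvσ]
    ring
  -- membership in the (symmetric) window
  have hmem : (-y ∈ Icc (-c) c) ↔ (y ∈ Icc (-c) c) := by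
    simp only [Set.mem_Icc]; constructor <;> rintro ⟨h₁, h₂⟩ <;> constructor <;> linarith
  rw [hF (-y), hF y]
  by_cases hy : y ∈ Icc (-c) c
  · rw [indicator_of_mem (hmem.2 hy), indicator_of_mem hy, harch, hvσ y]
    have hprime : ∀ n ∈ weilPrimeIndex c,
        (((ArithmeticFunction.vonMangoldt n : ℝ) / Real.sqrt n : ℝ) : ℂ) *
          (2 * (σ * v y) - v (-y - Real.log n) - v (-y + Real.log n)) =
        σ * ((((ArithmeticFunction.vonMangoldt n : ℝ) / Real.sqrt n : ℝ) : ℂ) *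
          (2 * v y - v (y - Real.log n) - v (y + Real.log n))) := by
      intro n _
      rw [show -y - Real.log n = -(y + Real.log n) by ring, show -y + Real.log n = -(y - Real.log n) by ring,
        hvσ, hvσ]
      ring
    rw [Finset.sum_congr rfl hprime, ← Finset.mul_sum, show -y / 2 = -(y / 2) by ring, Real.cosh_neg, Real.sinh_neg,
      Complex.ofReal_neg]
    -- replace the pole coefficients by their parity relations on the left
    conv_lhs => rw [hPc, hPs]
    ring
  · rw [indicator_of_notMem (fun h ↦ hy (hmem.1 h)), indicator_of_notMem hy, hvσ y]
    ring

/-! ## The residual: support, parity, realification -/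

section Residual

variable {k : ℕ} {g : Fin k → ℝ → ℝ} {v F : Fin k → ℝ → ℂ} {W : Fin k → Fin k → ℝ}

/-- The window image vanishes off the window. -/
theorem dt_windowImage_zero_off {vi Fi : ℝ → ℂ} (hvi0 : ∀ y, y ∉ Icc (-c) c → vi y = 0)
    (hF : ∀ y, Fi y = (Icc (-c) c).indicator (fun y ↦
        2 * (∫ x, vi x * (Real.cosh (x / 2) : ℂ)) * (Real.cosh (y / 2) : ℂ) -
          2 * (∫ x, vi x * (Real.sinh (x / 2) : ℂ)) * (Real.sinh (y / 2) : ℂ) +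
        (∑ n ∈ weilPrimeIndex c, (((ArithmeticFunction.vonMangoldt n : ℝ) / Real.sqrt n : ℝ) : ℂ) *
          (2 * vi y - vi (y - Real.log n) - vi (y + Real.log n))) +
        ∫ t in Ioi 0, (weilArchDensity t : ℂ) * (2 * vi y - vi (y - t) - vi (y + t))) y -
      (weilMarkovConstant c : ℂ) * vi y) {y : ℝ} (hy : y ∉ Icc (-c) c) : Fi y = 0 := by
  rw [hF y, indicator_of_notMem hy, hvi0 y hy]; ring

/-- **The realified residual on `[0, c)`**: with the real window-image expression of file XIV,
`(F_i − Σ_l W_il v_l)(y) = ↑(Φ_i(y) − Σ_l W_il g_l(y))`. [cite: Bombieri2000Weil, Thm 2] -/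
theorem dt_residual_real (hc : 0 < c) (hg : ∀ i, ContDiff ℝ 2 (g i))
    (hv : ∀ i x, v i x = (((Icc (-c) c).indicator (g i) x : ℝ) : ℂ))
    (hF : ∀ i y, F i y = (Icc (-c) c).indicator (fun y ↦
        2 * (∫ x, v i x * (Real.cosh (x / 2) : ℂ)) * (Real.cosh (y / 2) : ℂ) -
          2 * (∫ x, v i x * (Real.sinh (x / 2) : ℂ)) * (Real.sinh (y / 2) : ℂ) +
        (∑ n ∈ weilPrimeIndex c, (((ArithmeticFunction.vonMangoldt n : ℝ) / Real.sqrt n : ℝ) : ℂ) *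
          (2 * v i y - v i (y - Real.log n) - v i (y + Real.log n))) +
        ∫ t in Ioi 0, (weilArchDensity t : ℂ) * (2 * v i y - v i (y - t) - v i (y + t))) y -
      (weilMarkovConstant c : ℂ) * v i y)
    (i : Fin k) {y : ℝ} (hy : y ∈ Ico 0 c) :
    (F i - ∑ l, W i l • v l) y =
      ((2 * (∫ x in (-c)..c, g i x * Real.cosh (x / 2)) * Real.cosh (y / 2) -
          2 * (∫ x in (-c)..c, g i x * Real.sinh (x / 2)) * Real.sinh (y / 2) +
        (∑ n ∈ weilPrimeIndex c, ((ArithmeticFunction.vonMangoldt n : ℝ) / Real.sqrt n) *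
          (2 * g i y - (Icc (-c) c).indicator (g i) (y - Real.log n) -
            (Icc (-c) c).indicator (g i) (y + Real.log n))) +
        ((∫ t in Ioc 0 (c - y), weilArchDensityG t * ((2 * g i y - g i (y - t) - g i (y + t)) / t)) +
          (∫ t in Ioc (c - y) (c + y), weilArchDensityG t * ((g i y - g i (y - t)) / t)) +
          g i y * ((∫ t in Ioi (c - y), weilArchDensity t) + ∫ t in Ioi (c + y), weilArchDensity t)) -
        weilMarkovConstant c * g i y - ∑ l, W i l * g l y : ℝ) : ℂ) := by
  have hyI : y ∈ Icc (-c) c := ⟨by linarith [hy.1], hy.2.le⟩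
  have hvl : ∀ l, v l y = (g l y : ℂ) := fun l ↦ by rw [hv, dt_window_indicator_of_mem hyI]
  simp only [Pi.sub_apply, Finset.sum_apply, Pi.smul_apply, Complex.real_smul, hvl,
    dt_windowImage_real hc (hg i) (hv i) (hF i) hy]
  push_cast
  ring

/-- The residual is supported in the window. -/
theorem dt_residual_zero_off
    (hv : ∀ i x, v i x = (((Icc (-c) c).indicator (g i) x : ℝ) : ℂ))
    (hF : ∀ i y, F i y = (Icc (-c) c).indicator (fun y ↦
        2 * (∫ x, v i x * (Real.cosh (x / 2) : ℂ)) * (Real.cosh (y / 2) : ℂ) -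
          2 * (∫ x, v i x * (Real.sinh (x / 2) : ℂ)) * (Real.sinh (y / 2) : ℂ) +
        (∑ n ∈ weilPrimeIndex c, (((ArithmeticFunction.vonMangoldt n : ℝ) / Real.sqrt n : ℝ) : ℂ) *
          (2 * v i y - v i (y - Real.log n) - v i (y + Real.log n))) +
        ∫ t in Ioi 0, (weilArchDensity t : ℂ) * (2 * v i y - v i (y - t) - v i (y + t))) y -
      (weilMarkovConstant c : ℂ) * v i y)
    (i : Fin k) {y : ℝ} (hy : y ∉ Icc (-c) c) : (F i - ∑ l, W i l • v l) y = 0 := by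
  have hv0 : ∀ l, v l y = 0 := fun l ↦ by rw [hv, dt_window_indicator_of_not_mem hy]; simp
  simp only [Pi.sub_apply, Finset.sum_apply, Pi.smul_apply, hv0, smul_zero, Finset.sum_const_zero, sub_zero]
  exact dt_windowImage_zero_off (fun z hz ↦ by rw [hv, dt_window_indicator_of_not_mem hz]; simp) (hF i) hy

/-- The residual of a parity-`σ` family has parity `σ`: `r(−y) = σ r(y)`. -/
theorem dt_residual_reflect {σ : ℝ} (hgp : ∀ i x, g i (-x) = σ * g i x)
    (hv : ∀ i x, v i x = (((Icc (-c) c).indicator (g i) x : ℝ) : ℂ))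
    (hF : ∀ i y, F i y = (Icc (-c) c).indicator (fun y ↦
        2 * (∫ x, v i x * (Real.cosh (x / 2) : ℂ)) * (Real.cosh (y / 2) : ℂ) -
          2 * (∫ x, v i x * (Real.sinh (x / 2) : ℂ)) * (Real.sinh (y / 2) : ℂ) +
        (∑ n ∈ weilPrimeIndex c, (((ArithmeticFunction.vonMangoldt n : ℝ) / Real.sqrt n : ℝ) : ℂ) *
          (2 * v i y - v i (y - Real.log n) - v i (y + Real.log n))) +
        ∫ t in Ioi 0, (weilArchDensity t : ℂ) * (2 * v i y - v i (y - t) - v i (y + t))) y -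
      (weilMarkovConstant c : ℂ) * v i y)
    (i : Fin k) (y : ℝ) : (F i - ∑ l, W i l • v l) (-y) = (σ : ℂ) * (F i - ∑ l, W i l • v l) y := by
  have hvσ : ∀ l x, v l (-x) = (σ : ℂ) * v l x := by
    intro l x
    rw [hv, hv, dt_window_indicator_reflect x]
    by_cases hx : x ∈ Icc (-c) c
    · rw [indicator_of_mem hx, indicator_of_mem hx, hgp]; push_cast; ring
    · rw [indicator_of_notMem hx, indicator_of_notMem hx]; simp
  simp only [Pi.sub_apply, Finset.sum_apply, Pi.smul_apply, Complex.real_smul,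
    dt_windowImage_reflect_parity (hvσ i) (hF i) y, hvσ]
  rw [mul_sub, Finset.mul_sum]
  congr 1
  exact Finset.sum_congr rfl fun l _ ↦ by ring

end Residual

/-! ## From panel bounds to the residual norm -/

/-- `∫ ‖f‖² = 2 ∫_0^c ‖f‖²` for a function supported in `[-c, c]` with `‖f(−y)‖ = ‖f(y)‖` and `‖f‖²` integrable. -/
theorem dt_integral_normSq_eq_two_mul {f : ℝ → ℂ} (hc : 0 < c) (hfi : Integrable fun y ↦ ‖f y‖ ^ 2)
    (hf0 : ∀ y, y ∉ Icc (-c) c → f y = 0) (hfn : ∀ y, ‖f (-y)‖ = ‖f y‖) :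
    ∫ y, ‖f y‖ ^ 2 = 2 * ∫ y in (0 : ℝ)..c, ‖f y‖ ^ 2 := by
  have h1 : ∫ y, ‖f y‖ ^ 2 = ∫ y in Icc (-c) c, ‖f y‖ ^ 2 :=
    (setIntegral_eq_integral_of_forall_compl_eq_zero fun y hy ↦ by rw [hf0 y hy, norm_zero]; ring).symm
  have hii : ∀ a b : ℝ, IntervalIntegrable (fun y ↦ ‖f y‖ ^ 2) volume a b := fun a b ↦
    hfi.intervalIntegrable
  rw [h1, integral_Icc_eq_integral_Ioc, ← intervalIntegral.integral_of_le (by linarith),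
    ← intervalIntegral.integral_add_adjacent_intervals (hii (-c) 0) (hii 0 c)]
  have h2 : ∫ y in (-c)..0, ‖f y‖ ^ 2 = ∫ y in (0 : ℝ)..c, ‖f y‖ ^ 2 := by
    have h := intervalIntegral.integral_comp_neg (f := fun y ↦ ‖f y‖ ^ 2) (a := 0) (b := c)
    simp only [neg_zero, hfn] at h
    exact h.symm
  rw [h2]
  ring

/-- **The R-layer assembly: residual norm from panel bounds.**  Let the profiles `g_l ∈ C²` have the common parity `σ = ±1`,
`v_l = 𝟙_{[-c,c]} g_l`, `F_i` the explicit window images, `W` any real matrix, `m ≥ 1` panels of half-width `h = c/(2m)`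
centred at `y_k = (2k+1)h`.  If a real function `R` agrees with the residual `F_i − Σ_l W_il v_l` on `[0, c)` and
`∫_{-h}^{h} R(y_k + ρ)² dρ ≤ q_k` for every `k < m`, then `∫ ‖F_i − Σ_l W_il v_l‖² ≤ 2 Σ_{k<m} q_k` — the hypothesis `hs` of
the sigma criterion. [cite: GoerischHaunhorst1985, §2] [cite: Lehmann1963, §3] -/
theorem dt_residual_normSq_le_of_panels (hc : 0 < c) {k : ℕ} {σ : ℝ} (hσ : σ = 1 ∨ σ = -1)
    (g : Fin k → ℝ → ℝ) (hg : ∀ i, ContDiff ℝ 2 (g i)) (hgp : ∀ i x, g i (-x) = σ * g i x)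
    (v F : Fin k → ℝ → ℂ) (hv : ∀ i x, v i x = (((Icc (-c) c).indicator (g i) x : ℝ) : ℂ))
    (hF : ∀ i y, F i y = (Icc (-c) c).indicator (fun y ↦
        2 * (∫ x, v i x * (Real.cosh (x / 2) : ℂ)) * (Real.cosh (y / 2) : ℂ) -
          2 * (∫ x, v i x * (Real.sinh (x / 2) : ℂ)) * (Real.sinh (y / 2) : ℂ) +
        (∑ n ∈ weilPrimeIndex c, (((ArithmeticFunction.vonMangoldt n : ℝ) / Real.sqrt n : ℝ) : ℂ) *
          (2 * v i y - v i (y - Real.log n) - v i (y + Real.log n))) +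
        ∫ t in Ioi 0, (weilArchDensity t : ℂ) * (2 * v i y - v i (y - t) - v i (y + t))) y -
      (weilMarkovConstant c : ℂ) * v i y)
    (W : Fin k → Fin k → ℝ) (i : Fin k) {m : ℕ} (hm : 0 < m) (R : ℝ → ℝ)
    (hR : ∀ y ∈ Ico 0 c, (F i - ∑ l, W i l • v l) y = (R y : ℂ)) (q : ℕ → ℝ)
    (hq : ∀ j, j < m → ∫ ρ in (-(c / (2 * m)))..(c / (2 * m)), R ((2 * j + 1) * (c / (2 * m)) + ρ) ^ 2 ≤ q j) :
    ∫ y, ‖(F i - ∑ l, W i l • v l) y‖ ^ 2 ≤ 2 * ∑ j ∈ Finset.range m, q j := by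
  set r : ℝ → ℂ := F i - ∑ l, W i l • v l with hr
  set h : ℝ := c / (2 * m) with hh
  have hmr : (0 : ℝ) < m := by exact_mod_cast hm
  have hh0 : 0 < h := by rw [hh]; positivity
  have hch : c = 2 * m * h := by rw [hh]; field_simp
  -- `‖r‖²` is integrable, `r` is supported in the window and has parity `σ`
  have hrm : MemLp r 2 := dt_residual_memLp hc g hg v F hv hF W i
  have hri : Integrable fun y ↦ ‖r y‖ ^ 2 := (memLp_two_iff_integrable_sq_norm hrm.1).1 hrm
  have hr0 : ∀ y, y ∉ Icc (-c) c → r y = 0 := fun y hy ↦ dt_residual_zero_off hv hF i hy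
  have hrn : ∀ y, ‖r (-y)‖ = ‖r y‖ := fun y ↦ by
    rw [hr, dt_residual_reflect hgp hv hF i y, norm_mul, Complex.norm_real, Real.norm_eq_abs]
    rcases hσ with h1 | h1 <;> simp [h1]
  rw [dt_integral_normSq_eq_two_mul hc hri hr0 hrn, hch,
    intervalIntegral_eq_sum_panels (fun y ↦ ‖r y‖ ^ 2) hh0.le (fun a b _ _ ↦ hri.intervalIntegrable) m]
  refine mul_le_mul_of_nonneg_left (Finset.sum_le_sum fun j hj ↦ ?_) (by norm_num)
  have hjm : j < m := Finset.mem_range.1 hj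
  refine le_trans (le_of_eq ?_) (hq j hjm)
  -- on panel `j`, `‖r(y_j + ρ)‖² = R(y_j + ρ)²` for a.e. `ρ` (all `ρ ∈ (-h, h)`)
  refine intervalIntegral.integral_congr_ae ?_
  have hne : ∀ᵐ ρ : ℝ ∂volume, ρ ≠ h := by
    rw [ae_iff]; simp
  filter_upwards [hne] with ρ hρne hρ
  rw [uIoc_of_le (by linarith)] at hρ
  have hρlt : ρ < h := lt_of_le_of_ne hρ.2 hρne
  have hy : (2 * j + 1) * h + ρ ∈ Ico 0 c := by
    have hj0 : (0 : ℝ) ≤ j := by exact_mod_cast Nat.zero_le j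
    have hj1 : (j : ℝ) + 1 ≤ m := by exact_mod_cast hjm
    constructor
    · nlinarith [hρ.1]
    · rw [hch]; nlinarith
  rw [show r ((2 * j + 1) * h + ρ) = (R ((2 * j + 1) * h + ρ) : ℂ) from hR _ hy, Complex.norm_real,
    Real.norm_eq_abs, sq_abs]

/-- **Integrability on a panel** (the side condition of `integral_sq_le_sqIntegUpperQ`): under the hypotheses of
`dt_residual_normSq_le_of_panels`, `ρ ↦ R(y_j + ρ)²` is interval integrable on `[-h, h]` for every `j < m`. -/
theorem dt_residual_sq_intervalIntegrable (hc : 0 < c) {k : ℕ}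
    (g : Fin k → ℝ → ℝ) (hg : ∀ i, ContDiff ℝ 2 (g i))
    (v F : Fin k → ℝ → ℂ) (hv : ∀ i x, v i x = (((Icc (-c) c).indicator (g i) x : ℝ) : ℂ))
    (hF : ∀ i y, F i y = (Icc (-c) c).indicator (fun y ↦
        2 * (∫ x, v i x * (Real.cosh (x / 2) : ℂ)) * (Real.cosh (y / 2) : ℂ) -
          2 * (∫ x, v i x * (Real.sinh (x / 2) : ℂ)) * (Real.sinh (y / 2) : ℂ) +
        (∑ n ∈ weilPrimeIndex c, (((ArithmeticFunction.vonMangoldt n : ℝ) / Real.sqrt n : ℝ) : ℂ) *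
          (2 * v i y - v i (y - Real.log n) - v i (y + Real.log n))) +
        ∫ t in Ioi 0, (weilArchDensity t : ℂ) * (2 * v i y - v i (y - t) - v i (y + t))) y -
      (weilMarkovConstant c : ℂ) * v i y)
    (W : Fin k → Fin k → ℝ) (i : Fin k) {m : ℕ} (hm : 0 < m) (R : ℝ → ℝ)
    (hR : ∀ y ∈ Ico 0 c, (F i - ∑ l, W i l • v l) y = (R y : ℂ)) {j : ℕ} (hjm : j < m) :
    IntervalIntegrable (fun ρ ↦ R ((2 * j + 1) * (c / (2 * m)) + ρ) ^ 2) volume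
      (-(c / (2 * m))) (c / (2 * m)) := by
  set r : ℝ → ℂ := F i - ∑ l, W i l • v l with hr
  set h : ℝ := c / (2 * m) with hh
  have hmr : (0 : ℝ) < m := by exact_mod_cast hm
  have hh0 : 0 < h := by rw [hh]; positivity
  have hch : c = 2 * m * h := by rw [hh]; field_simp
  have hrm : MemLp r 2 := dt_residual_memLp hc g hg v F hv hF W i
  have hri : Integrable fun y ↦ ‖r y‖ ^ 2 := (memLp_two_iff_integrable_sq_norm hrm.1).1 hrm
  -- the shifted `‖r‖²` is integrable; it agrees with `R(y_j + ·)²` a.e. on the panel `(-h, h]`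
  have hI : IntegrableOn (fun ρ ↦ ‖r ((2 * j + 1) * h + ρ)‖ ^ 2) (Ioc (-h) h) :=
    (hri.comp_add_left ((2 * j + 1) * h)).integrableOn
  have hne : ∀ᵐ ρ : ℝ ∂volume, ρ ≠ h := by
    rw [ae_iff]; simp
  have hae : (fun ρ ↦ ‖r ((2 * j + 1) * h + ρ)‖ ^ 2) =ᵐ[volume.restrict (Ioc (-h) h)]
      fun ρ ↦ R ((2 * j + 1) * h + ρ) ^ 2 := by
    rw [EventuallyEq, ae_restrict_iff' measurableSet_Ioc]
    filter_upwards [hne] with ρ hρne hρ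
    have hρlt : ρ < h := lt_of_le_of_ne hρ.2 hρne
    have hy : (2 * j + 1) * h + ρ ∈ Ico 0 c := by
      have hj0 : (0 : ℝ) ≤ j := by exact_mod_cast Nat.zero_le j
      have hj1 : (j : ℝ) + 1 ≤ m := by exact_mod_cast hjm
      constructor
      · nlinarith [hρ.1]
      · rw [hch]; nlinarith
    rw [show r ((2 * j + 1) * h + ρ) = (R ((2 * j + 1) * h + ρ) : ℂ) from hR _ hy, Complex.norm_real,
      Real.norm_eq_abs, sq_abs]
  exact (intervalIntegrable_iff_integrableOn_Ioc_of_le (by linarith)).2 (hI.congr_fun_ae hae)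

end Summit.RiemannHypothesis.RiemannHypothesis.Theorems.EvenWinsBeyondArch

end
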